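import Summits.CriticalPhenomena.PercolationContinuityZ3.Theorems.Transplant.FKConnectivityAllQAntipodalX2WordsSigmaHall
import Summits.CriticalPhenomena.PercolationContinuityZ3.Theorems.Transplant.FKConnectivityAllQAntipodalSplitDefs
import HarnessLib

/-!
# Connectivity correlation inequalities for `φ_{w,q}` — file (DEFINITION): the SPINE of a marked edge in a two-terminal
# series–parallel network, the σ-word of a configuration, and the fibre sums of the cross functional `X2`

Definitions file (`--supports stmt-CriticalPhenomena-4575`), FK sub-lane `prim-bschramm-fk-2` (gen 14) of the post-continuity
programme; builds on p205010 (kernel theorem, internal audit signed; external expert review pending).  No named facts, no sorries,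
no measure theory; standard axioms.

CONTEXT (memos `bschramm/FROM-fk-2-g12-SPLIT-UPC.md` §4.2, `bschramm/FROM-fk-2-g13-WORD-HALL.md` §5.1/§7.3, FK-Q2.md §21–23).  The node
`FK.ApX2Pos` of `…AntipodalSplitDefs` (`apX2 q T s t u v g ≥ 0` for every `q > 0` whenever `E` is two-terminal series–parallel between
`s, t`, `uv ∈ E`, `T ⊆ E ∖ uv`, `g` monotone) is proved in the sibling files `…X2Spine*.lean` / `…X2Pos.lean` by the route of memo g13
§5.1: along the SPINE of the marked edge `z = uv` — the chain `{z} = M₀ ⊂ M₁ ⊂ ⋯ ⊂ M_L = E`, `M_{i+1} = M_i ∘ R_i` a series or parallel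
composition with a two-terminal series–parallel PART `R_i` — the sign `1{s ↔ t in B}·1{u ↮ v in T∖B}` and the antipodal exponent
`k(B) + k(T∖B)` of a configuration `B ⊆ T` factor through the σ-WORD of `B` (one letter `(kind_i, 1{B ∩ R_i joins the terminals of R_i},
1{(T∖B) ∩ R_i joins them})` per part), the word model of `…X2WordsSigma`; WORD-HALL (`FK.X2Word.sigma_wordHall`) and one application
of Theorem U (`FK.apUpc_nonneg_of_isTTSP`) per flipped part then give `apX2 ≥ 0`.
THIS FILE fixes the vocabulary:
* `FK.SpinePart` — a part `R` with its kind (`W` = series, `P` = parallel) and terminals `x` (the terminal shared with the inner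
  composite) and `y`; `FK.SpinePart.Glue p M a b a' b'` — `p` is glued onto the inner composite `M` (terminals `a, b`) giving terminals
  `a', b'`, with LITERALLY the side conditions of the constructors of `FK.IsTTSP` (parallel across `a, b`; series at `a`; series at `b`);
  `FK.IsSpine ps M a b E s t` — the list of parts `ps` (innermost first) leads from `(M; a, b)` to `(E; s, t)`.
* `FK.SpinePart.bit`, `FK.spineWord ps T B` (the σ-word of `B`), `FK.rowVis`/`FK.rowOf` (one row: the visible letters — walls
  `(W, 0)` and particles `(P, 1)`), `FK.adjP` (number of adjacent particle pairs read with an initial flag), `FK.PairState`/`FK.runK`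
  (the three-state automaton joined / straddling / dead of the marked pair) and `FK.PairState.Holds` (its graph-theoretic meaning),
  `FK.allWords`, `FK.expSum` (sum of the parts' antipodal exponents), `FK.fiberSum` (the `g`-mass of the configurations with a given
  word), `FK.swapLetter`, `FK.nP` (number of particles of the two rows), `FK.sSign`, `FK.wordCoef`.
Only definitions, unfolding lemmas and small sanity instances here.
[cite: Grimmett2006, §1.4 eq. (1.20) (p. 15); §3.9 (p. 63)]
-/

noncomputable section

namespace Summit.CriticalPhenomena.PercolationContinuityZ3.Theorems

namespace FK

open SimpleGraph Literature.Probability.LatticeModels Literature.Probability.Percolation X2Word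
open scoped Classical

variable {V : Type*}

/-! ### Parts, gluing, spines -/

/-- A PART of the spine of a marked edge: its kind (`W` = attached in series, `P` = in parallel), its edge set `R`, the terminal `x`
it shares with the inner composite and its other terminal `y` (memo g12 §4.2: the siblings `R_i` met along the path from the marked
leaf to the root of the decomposition tree). [folklore] -/
structure SpinePart (V : Type*) where
  /-- kind of the composition: `W` series, `P` parallel -/
  kind : Kind
  /-- the edge set of the part -/
  R : Finset (Sym2 V)
  /-- the terminal shared with the inner composite -/
  x : V
  /-- the other terminal of the part -/
  y : V

/-- **Gluing a part onto the inner composite** `M` with terminals `a, b`, producing the terminals `a', b'` of `M ∪ R`: parallel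
composition across `a, b` (`R` two-terminal series–parallel between `a` and `b`), series composition at `a` (`R` between `a` and the
new terminal `a'`) or at `b` (`R` between `b` and the new terminal `b'`) — with literally the side conditions of the constructors of
`FK.IsTTSP` (edge-disjointness, spanned vertex sets meeting only in the interface, far terminals off the other part). [folklore] -/
inductive SpinePart.Glue : SpinePart V → Finset (Sym2 V) → V → V → V → V → Prop
  /-- parallel composition across the terminals `a, b` -/
  | par {M R : Finset (Sym2 V)} {a b : V} (hR : IsTTSP R a b) (hd : Disjoint M R)
      (hV : ∀ z : V, (∃ e ∈ M, z ∈ e) → (∃ e ∈ R, z ∈ e) → z = a ∨ z = b) :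
      SpinePart.Glue ⟨.P, R, a, b⟩ M a b a b
  /-- series composition at the terminal `a`; the new terminal is `a'` -/
  | serA {M R : Finset (Sym2 V)} {a b a' : V} (hR : IsTTSP R a a') (hd : Disjoint M R)
      (hV : ∀ z : V, (∃ e ∈ M, z ∈ e) → (∃ e ∈ R, z ∈ e) → z = a) (hb : ∀ e ∈ R, b ∉ e) (ha' : ∀ e ∈ M, a' ∉ e) :
      SpinePart.Glue ⟨.W, R, a, a'⟩ M a b a' b
  /-- series composition at the terminal `b`; the new terminal is `b'` -/
  | serB {M R : Finset (Sym2 V)} {a b b' : V} (hR : IsTTSP R b b') (hd : Disjoint M R)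
      (hV : ∀ z : V, (∃ e ∈ M, z ∈ e) → (∃ e ∈ R, z ∈ e) → z = b) (ha : ∀ e ∈ R, a ∉ e) (hb' : ∀ e ∈ M, b' ∉ e) :
      SpinePart.Glue ⟨.W, R, b, b'⟩ M a b a b'

/-- **Spine**: `IsSpine ps M a b E s t` — gluing the parts of `ps` one after the other (innermost first) onto the composite `M` with
terminals `a, b` yields the network `E` with terminals `s, t`. [folklore] -/
def IsSpine : List (SpinePart V) → Finset (Sym2 V) → V → V → Finset (Sym2 V) → V → V → Prop
  | [], M, a, b, E, s, t => M = E ∧ a = s ∧ b = t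
  | p :: ps, M, a, b, E, s, t => ∃ a' b', p.Glue M a b a' b' ∧ IsSpine ps (M ∪ p.R) a' b' E s t

/-- Unfolding `IsSpine` on the empty list. [folklore] -/
theorem isSpine_nil {M E : Finset (Sym2 V)} {a b s t : V} : IsSpine [] M a b E s t ↔ M = E ∧ a = s ∧ b = t := Iff.rfl

/-- Unfolding `IsSpine` on a `cons`. [folklore] -/
theorem isSpine_cons {p : SpinePart V} {ps : List (SpinePart V)} {M E : Finset (Sym2 V)} {a b s t : V} :
    IsSpine (p :: ps) M a b E s t ↔ ∃ a' b', p.Glue M a b a' b' ∧ IsSpine ps (M ∪ p.R) a' b' E s t := Iff.rfl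

/-- The part of a gluing is two-terminal series–parallel between its terminals. [folklore] -/
theorem SpinePart.Glue.isTTSP {p : SpinePart V} {M : Finset (Sym2 V)} {a b a' b' : V} (h : p.Glue M a b a' b') :
    IsTTSP p.R p.x p.y := by
  cases h with
  | par hR => exact hR
  | serA hR => exact hR
  | serB hR => exact hR

/-- The part of a gluing is edge-disjoint from the inner composite. [folklore] -/
theorem SpinePart.Glue.disjoint {p : SpinePart V} {M : Finset (Sym2 V)} {a b a' b' : V} (h : p.Glue M a b a' b') :
    Disjoint M p.R := by
  cases h with
  | par _ hd => exact hd
  | serA _ hd => exact hd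
  | serB _ hd => exact hd

/-! ### The σ-word of a configuration along a spine; rows; automata -/

/-- The connection bit of the configuration `ω` on the part `p`: do the open edges of `ω` inside `p.R` join the terminals of `p`? [folklore] -/
def SpinePart.bit (p : SpinePart V) (ω : Finset (Sym2 V)) : Bool :=
  decide ((openGraph (↑(ω ∩ p.R) : BondConfig V)).Reachable p.x p.y)

/-- The letter of the configuration `B ⊆ T` at the part `p`: `(kind, bit of B, bit of T ∖ B)` (memo g12 §4.2). [folklore] -/
def SpinePart.letter (p : SpinePart V) (T B : Finset (Sym2 V)) : SLetter := (p.kind, p.bit B, p.bit (T \ B))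

/-- The σ-WORD of the configuration `B ⊆ T` along the spine `ps` (innermost letter first). [folklore] -/
def spineWord (ps : List (SpinePart V)) (T B : Finset (Sym2 V)) : List SLetter := ps.map fun p => p.letter T B

/-- Visibility of one position to one row: a series position is visible iff its bit is `false` (a WALL), a parallel position iff its
bit is `true` (a PARTICLE); `sVisA (k, b, b̄) = rowVis k b`, `sVisB (k, b, b̄) = rowVis k b̄`. [folklore] -/
def rowVis : Kind → Bool → Bool
  | .W, b => !b
  | .P, b => b

/-- The ROW of the configuration `ω` along the spine: the kinds of the visible positions, in order. [folklore] -/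
def rowOf (ps : List (SpinePart V)) (ω : Finset (Sym2 V)) : List Kind :=
  (ps.filter fun p => rowVis p.kind (p.bit ω)).map (·.kind)

/-- Number of ADJACENT particle pairs of a row word read after a letter whose particle flag is `b`
(`adjP b l + runsAux b l = #P(l)`, file `…X2SpineRows`). [folklore] -/
def adjP : Bool → List Kind → ℕ
  | _, [] => 0
  | b, .P :: l => (if b then 1 else 0) + adjP true l
  | _, .W :: l => adjP false l

/-- State of the marked pair `u, v` relative to the current composite: `J` joined, `S` straddling (separated, `u` with the left
terminal and `v` with the right one), `D` dead (memo g12 §1.4). [folklore] -/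
inductive PairState | J | S | D
  deriving DecidableEq, Repr, Inhabited

/-- The pair-state automaton run on a row word: `J` and `D` are absorbing; from `S` the first visible letter decides — a particle joins
the pair (`J`), a wall kills it (`D`) (memo g12 §1.4: parallel `S ↦ J` iff the part joins, series `S ↦ D` iff it does not). [folklore] -/
def runK : PairState → List Kind → PairState
  | .J, _ => .J
  | .D, _ => .D
  | .S, [] => .S
  | .S, .P :: _ => .J
  | .S, .W :: _ => .D

/-- Graph-theoretic meaning of a pair state for the configuration `ω`, the current terminals `a, b` and the marked pair `u, v`:
`J`: `u ↔ v`; `S`: `u ↮ v`, `u ↔ a`, `v ↔ b`; `D`: `u ↮ v` even after wiring `a` to `b`. [folklore] -/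
def PairState.Holds : PairState → BondConfig V → V → V → V → V → Prop
  | .J, ω, _, _, u, v => (openGraph ω).Reachable u v
  | .S, ω, a, b, u, v => ¬ (openGraph ω).Reachable u v ∧ (openGraph ω).Reachable u a ∧ (openGraph ω).Reachable v b
  | .D, ω, a, b, u, v => ¬ (openGraph (ω ∪ {s(a, b)})).Reachable u v

/-! ### All words of a spine shape, exponents, fibre sums, particle counts -/

/-- All σ-words of the shape of the spine `ps` (kinds prescribed, bits free). [folklore] -/
def allWords : List (SpinePart V) → Finset (List SLetter)
  | [] => {[]}
  | p :: ps => ((Finset.univ : Finset (Bool × Bool)) ×ˢ allWords ps).image fun c => (p.kind, c.1.1, c.1.2) :: c.2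

/-- Sum of the antipodal exponents of the parts: `∑_i (k(B ∩ R_i) + k((T ∖ B) ∩ R_i))` with `T ∩ R_i` as the ambient set of part `i`. [folklore] -/
def expSum (ps : List (SpinePart V)) (T B : Finset (Sym2 V)) : ℕ := (ps.map fun p => apExp (T ∩ p.R) (B ∩ p.R)).sum

/-- FIBRE SUM of the word `w`: the `g`-mass `∑_{B ⊆ T : word(B) = w} q^{expSum B} g(B)` of the configurations with σ-word `w`
(`S̃(w)` of memo g13 §5.1, without the word-dependent factor `q^{corr}`). [folklore] -/
def fiberSum (q : ℝ) (ps : List (SpinePart V)) (T : Finset (Sym2 V)) (g : Finset (Sym2 V) → ℝ) (w : List SLetter) : ℝ :=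
  ∑ B ∈ T.powerset.filter (fun B => spineWord ps T B = w), q ^ expSum ps T B * g B

/-- Exchange the two rows of a letter: `(k, b, b̄) ↦ (k, b̄, b)` (the word of `T ∖ B` is the swapped word of `B`). [folklore] -/
def swapLetter (l : SLetter) : SLetter := (l.1, l.2.2, l.2.1)

/-- Number of particles of the two rows of a σ-word (`corr(b) + corr(b̄) = nP - sRuns`, memo g12 §4.2). [folklore] -/
def nP (w : List SLetter) : ℕ := (sRowA w).count .P + (sRowB w).count .P

/-- The sign of a σ-word in `X2`: `+1` on winners, `-1` on losers, `0` otherwise. [folklore] -/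
def sSign (w : List SLetter) : ℝ := (if sIsWinner w then 1 else 0) - (if sIsLoser w then 1 else 0)

/-- The word-dependent part of the antipodal weight along a spine with `L` parts on `K` vertices:
`q^{k(B)+k(T∖B)} = wordCoef q K L (word B) · q^{expSum B}` with `wordCoef q K L w = q^{2K + nP w} / q^{2LK + sRuns w}`
(file `…X2Pos`: `k(B) + k(T∖B) + 2LK + sRuns = 2K + expSum + nP`). [folklore] -/
def wordCoef (q : ℝ) (K L : ℕ) (w : List SLetter) : ℝ := q ^ (2 * K + nP w) / q ^ (2 * (L * K) + sRuns w)

/-! ### Unfolding lemmas and sanity instances -/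

/-- `sVisA` reads the first bit through `rowVis`. [folklore] -/
@[simp] theorem sVisA_eq (k : Kind) (b bb : Bool) : sVisA (k, b, bb) = rowVis k b := by cases k <;> rfl
/-- `sVisB` reads the second bit through `rowVis`. [folklore] -/
@[simp] theorem sVisB_eq (k : Kind) (b bb : Bool) : sVisB (k, b, bb) = rowVis k bb := by cases k <;> rfl

/-- `spineWord` of the empty spine. [folklore] -/
@[simp] theorem spineWord_nil (T B : Finset (Sym2 V)) : spineWord [] T B = [] := rfl
/-- `spineWord`, one part at a time. [folklore] -/
theorem spineWord_cons (p : SpinePart V) (ps : List (SpinePart V)) (T B : Finset (Sym2 V)) :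
    spineWord (p :: ps) T B = p.letter T B :: spineWord ps T B := rfl
/-- `rowOf` of the empty spine. [folklore] -/
@[simp] theorem rowOf_nil (ω : Finset (Sym2 V)) : rowOf [] ω = [] := rfl
/-- `rowOf`, one part at a time. [folklore] -/
theorem rowOf_cons (p : SpinePart V) (ps : List (SpinePart V)) (ω : Finset (Sym2 V)) :
    rowOf (p :: ps) ω = (if rowVis p.kind (p.bit ω) then [p.kind] else []) ++ rowOf ps ω := by
  unfold rowOf; rw [List.filter_cons]; split_ifs <;> simp
/-- `expSum` of the empty spine. [folklore] -/
@[simp] theorem expSum_nil (T B : Finset (Sym2 V)) : expSum [] T B = 0 := rfl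
/-- `expSum`, one part at a time. [folklore] -/
theorem expSum_cons (p : SpinePart V) (ps : List (SpinePart V)) (T B : Finset (Sym2 V)) :
    expSum (p :: ps) T B = apExp (T ∩ p.R) (B ∩ p.R) + expSum ps T B := by
  simp [expSum]
/-- `allWords` of the empty spine. [folklore] -/
@[simp] theorem allWords_nil : allWords ([] : List (SpinePart V)) = {[]} := rfl
/-- Membership in `allWords`, one part at a time. [folklore] -/
theorem mem_allWords_cons {p : SpinePart V} {ps : List (SpinePart V)} {w : List SLetter} :
    w ∈ allWords (p :: ps) ↔ ∃ b bb : Bool, ∃ w' ∈ allWords ps, w = (p.kind, b, bb) :: w' := by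
  rw [allWords]
  simp only [Finset.mem_image, Finset.mem_product, Finset.mem_univ, true_and, Prod.exists]
  constructor
  · rintro ⟨b, bb, w', hw', rfl⟩; exact ⟨b, bb, w', hw', rfl⟩
  · rintro ⟨b, bb, w', hw', rfl⟩; exact ⟨b, bb, w', hw', rfl⟩
/-- `runK` from an absorbing state. [folklore] -/
@[simp] theorem runK_J (l : List Kind) : runK .J l = .J := by cases l <;> rfl
/-- `runK` from the dead state. [folklore] -/
@[simp] theorem runK_D (l : List Kind) : runK .D l = .D := by cases l <;> rfl
/-- `runK` along a concatenation. [folklore] -/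
theorem runK_append (st : PairState) (l₁ l₂ : List Kind) : runK st (l₁ ++ l₂) = runK (runK st l₁) l₂ := by
  cases st with
  | J => simp
  | D => simp
  | S =>
    cases l₁ with
    | nil => rfl
    | cons k l => cases k <;> simp [runK]
/-- `adjP` along a concatenation (the flag after the first word is `lastFlag`). [folklore] -/
theorem adjP_append (b : Bool) (l₁ l₂ : List Kind) : adjP b (l₁ ++ l₂) = adjP b l₁ + adjP (lastFlag b l₁) l₂ := by
  induction l₁ generalizing b with
  | nil => simp [adjP, lastFlag]
  | cons a l ih =>
    rw [List.cons_append, lastFlag_cons]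
    cases a with
    | W => simp only [adjP, ih]; rfl
    | P => simp only [adjP, ih, Nat.add_assoc]; rfl
/-- `swapLetter` is an involution. [folklore] -/
@[simp] theorem swapLetter_swapLetter (l : SLetter) : swapLetter (swapLetter l) = l := rfl

/-- Sanity: the automaton from the straddling state. [folklore] -/
example : runK .S [.W, .P] = .D ∧ runK .S [.P, .W] = .J ∧ runK .S [] = .S := by decide
/-- Sanity: two adjacent particle pairs in `P P W P P`, three if the initial flag is set. [folklore] -/
example : adjP false [.P, .P, .W, .P, .P] = 2 ∧ adjP true [.P, .P, .W, .P, .P] = 3 := by decide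

end FK

end Summit.CriticalPhenomena.PercolationContinuityZ3.Theorems

end
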